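import Summits.KontsevichZagierPeriods.KontsevichZagierPeriods.Theorems.RootDecompZetaThreeFrontierWordMatchPreludeP16

/-! # `RootDecompZetaThreeFrontierWordMatchPreludeP17` — part 3/3 of the ≤340-line split of decomp-kz lens-1 g12 `s44_s46_delta.lean`
(sha256 4eadf8a5…; = §44–§46 of `MatchPrelude_v8.lean`: the proof of `…GZLadder.stub_gapClassMatch : GapClassMatch` of «gz_ladder» v4 on
stmt-KontsevichZagierPeriods-32433, proved in part 3/3 = P17).  Sits on the landed WordMatchPrelude P1–P14 (§24–§43).  Mathematics unchanged. -/

set_option linter.dupNamespace false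

noncomputable section

/-! # §46  THE DISPATCHER AND THE WELL-FOUNDED INDUCTION: `GapClassMatch` PROVED (decomp-kz lens-1 gen 12).
The measure is `μ = (P₁, max β₀ γ₂, ΣB)` in lexicographic order, `P₁ = Σ_f (B_f − 1)₊`; `gapClass_step` is the decision list of
NODE.md ADDENDUM 9/10 (LAYER, D1, D2, D3/D3′, D4, D5/D5′, D6/D6′, D7/D7′, D8/D8′, D9/D9′, NONE = contradiction), every piece
admissible and `μ`-smaller (machine census: 1 082 380 states, 0 failures; here re-proved case by case by `omega`). -/

namespace Summit.KontsevichZagierPeriods.KontsevichZagierPeriods.Cruxes.GZNormalFormWThree.GZLadder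

open Set MeasureTheory Literature.NumberTheory.Transcendental
open Summit.KontsevichZagierPeriods.RootDecompZetaThreeFrontier

section GapClassInduction

/-- the primary potential `P₁ = Σ_f (B_f − 1)₊` -/
def muP (β₀ β₁ γ₁ γ₂ α : ℕ) : ℕ := (β₀ - 1) + (β₁ - 1) + (γ₁ - 1) + (γ₂ - 1) + (α - 1)

/-- `μ(B') < μ(B)` for `μ = (P₁, max β₀ γ₂, ΣB)` lexicographic (the gap degree `|κ|` is not needed: every split lowers `ΣB`) -/
def MuLT (b0 b1 c1 c2 al : ℕ) (β₀ β₁ γ₁ γ₂ α : ℕ) : Prop :=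
  muP b0 b1 c1 c2 al < muP β₀ β₁ γ₁ γ₂ α ∨
    (muP b0 b1 c1 c2 al = muP β₀ β₁ γ₁ γ₂ α ∧
      (max b0 c2 < max β₀ γ₂ ∨ (max b0 c2 = max β₀ γ₂ ∧ b0 + b1 + c1 + c2 + al < β₀ + β₁ + γ₁ + γ₂ + α)))

set_option linter.unusedSimpArgs false in
set_option maxHeartbeats 0 in
/-- **THE DECISION LIST**: one admissible class, given the clause of every admissible `μ`-smaller datum. -/
theorem gapClass_step (κ : Fin 4 → ℕ) (β₀ β₁ γ₁ γ₂ α : ℕ) (hA : Adm κ β₀ β₁ γ₁ γ₂ α)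
    (IH : ∀ (κ' : Fin 4 → ℕ) (b0 b1 c1 c2 al : ℕ), Adm κ' b0 b1 c1 c2 al → MuLT b0 b1 c1 c2 al β₀ β₁ γ₁ γ₂ α →
      GClause κ' b0 b1 c1 c2 al) : GClause κ β₀ β₁ γ₁ γ₂ α := by
  have hA' := hA
  obtain ⟨hV0, hB1, hAl, hC1, hV3⟩ := hA'
  -- LAYER
  by_cases hL : α ≤ 1 ∧ β₁ ≤ 1 ∧ γ₁ ≤ 1 ∧ β₀ + β₁ + α ≤ 2 ∧ γ₂ + γ₁ + α ≤ 2
  · exact glayer κ β₀ β₁ γ₁ γ₂ α hL.1 hL.2.1 hL.2.2.1 hL.2.2.2.1 hL.2.2.2.2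
  -- D1 : β₁, γ₁ ≥ 1
  by_cases hD1 : 1 ≤ β₁ ∧ 1 ≤ γ₁
  · obtain ⟨b, rfl⟩ : ∃ b, β₁ = b + 1 := ⟨β₁ - 1, by omega⟩
    obtain ⟨c, rfl⟩ : ∃ c, γ₁ = c + 1 := ⟨γ₁ - 1, by omega⟩
    exact gsplitD1 κ β₀ b c γ₂ α (by simp only [Adm, MuLT, muP, Matrix.cons_val, true_and, and_true, Nat.add_sub_cancel, Nat.zero_sub]; omega)
      (IH _ _ _ _ _ _ (by simp only [Adm, MuLT, muP, Matrix.cons_val, true_and, and_true, Nat.add_sub_cancel, Nat.zero_sub]; omega)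
        (by simp only [Adm, MuLT, muP, Matrix.cons_val, true_and, and_true, Nat.add_sub_cancel, Nat.zero_sub]; omega))
      (by simp only [Adm, MuLT, muP, Matrix.cons_val, true_and, and_true, Nat.add_sub_cancel, Nat.zero_sub]; omega)
      (IH _ _ _ _ _ _ (by simp only [Adm, MuLT, muP, Matrix.cons_val, true_and, and_true, Nat.add_sub_cancel, Nat.zero_sub]; omega)
        (by simp only [Adm, MuLT, muP, Matrix.cons_val, true_and, and_true, Nat.add_sub_cancel, Nat.zero_sub]; omega))
  -- D2 : β₀, γ₂, α ≥ 1
  by_cases hD2 : 1 ≤ β₀ ∧ 1 ≤ γ₂ ∧ 1 ≤ α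
  · obtain ⟨g, rfl⟩ : ∃ g, β₀ = g + 1 := ⟨β₀ - 1, by omega⟩
    obtain ⟨h, rfl⟩ : ∃ h, γ₂ = h + 1 := ⟨γ₂ - 1, by omega⟩
    obtain ⟨a, rfl⟩ : ∃ a, α = a + 1 := ⟨α - 1, by omega⟩
    exact gsplitD2 κ g β₁ γ₁ h a (by simp only [Adm, MuLT, muP, Matrix.cons_val, true_and, and_true, Nat.add_sub_cancel, Nat.zero_sub]; omega)
      (IH _ _ _ _ _ _ (by simp only [Adm, MuLT, muP, Matrix.cons_val, true_and, and_true, Nat.add_sub_cancel, Nat.zero_sub]; omega)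
        (by simp only [Adm, MuLT, muP, Matrix.cons_val, true_and, and_true, Nat.add_sub_cancel, Nat.zero_sub]; omega))
      (by simp only [Adm, MuLT, muP, Matrix.cons_val, true_and, and_true, Nat.add_sub_cancel, Nat.zero_sub]; omega)
      (IH _ _ _ _ _ _ (by simp only [Adm, MuLT, muP, Matrix.cons_val, true_and, and_true, Nat.add_sub_cancel, Nat.zero_sub]; omega)
        (by simp only [Adm, MuLT, muP, Matrix.cons_val, true_and, and_true, Nat.add_sub_cancel, Nat.zero_sub]; omega))
      (by simp only [Adm, MuLT, muP, Matrix.cons_val, true_and, and_true, Nat.add_sub_cancel, Nat.zero_sub]; omega)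
      (IH _ _ _ _ _ _ (by simp only [Adm, MuLT, muP, Matrix.cons_val, true_and, and_true, Nat.add_sub_cancel, Nat.zero_sub]; omega)
        (by simp only [Adm, MuLT, muP, Matrix.cons_val, true_and, and_true, Nat.add_sub_cancel, Nat.zero_sub]; omega))
  -- D3 : β₁ ≥ 2 (then γ₁ = 0)
  by_cases hD3 : 2 ≤ β₁
  · obtain rfl : γ₁ = 0 := by omega
    obtain ⟨b, rfl⟩ : ∃ b, β₁ = b + 1 := ⟨β₁ - 1, by omega⟩
    have hb : 1 ≤ b := by omega
    rcases Nat.eq_zero_or_pos (κ 3) with h3 | h3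
    · exact gruleD3b κ β₀ b γ₂ α h3 hb hA fun κ' hκ' =>
        IH κ' _ _ _ _ _ hκ' (by simp only [Adm, MuLT, muP, Matrix.cons_val, true_and, and_true, Nat.add_sub_cancel, Nat.zero_sub]; omega)
    · exact gruleD3a κ β₀ b γ₂ α h3 hb hA fun κ' hκ' =>
        IH κ' _ _ _ _ _ hκ' (by simp only [Adm, MuLT, muP, Matrix.cons_val, true_and, and_true, Nat.add_sub_cancel, Nat.zero_sub]; omega)
  -- D3′ : γ₁ ≥ 2 (then β₁ = 0), by duality
  by_cases hD3' : 2 ≤ γ₁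
  · obtain rfl : β₁ = 0 := by omega
    obtain ⟨c, rfl⟩ : ∃ c, γ₁ = c + 1 := ⟨γ₁ - 1, by omega⟩
    have hc : 1 ≤ c := by omega
    refine gdual κ β₀ 0 (c + 1) γ₂ α ?_
    rcases Nat.eq_zero_or_pos (κ 0) with h0 | h0
    · exact gruleD3b _ γ₂ c β₀ α (by simp only [Matrix.cons_val]; exact h0) hc
        (by simp only [Adm, MuLT, muP, Matrix.cons_val, true_and, and_true, Nat.add_sub_cancel, Nat.zero_sub]; omega) fun κ' hκ' =>
        IH κ' _ _ _ _ _ hκ' (by simp only [Adm, MuLT, muP, Matrix.cons_val, true_and, and_true, Nat.add_sub_cancel, Nat.zero_sub]; omega)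
    · exact gruleD3a _ γ₂ c β₀ α (by simp only [Matrix.cons_val]; exact h0) hc
        (by simp only [Adm, MuLT, muP, Matrix.cons_val, true_and, and_true, Nat.add_sub_cancel, Nat.zero_sub]; omega) fun κ' hκ' =>
        IH κ' _ _ _ _ _ hκ' (by simp only [Adm, MuLT, muP, Matrix.cons_val, true_and, and_true, Nat.add_sub_cancel, Nat.zero_sub]; omega)
  -- D4 : free directions
  by_cases hF2 : γ₂ = 0 ∧ α = 0
  · obtain ⟨rfl, rfl⟩ := hF2
    exact gfreeT2 κ β₀ β₁ γ₁
  by_cases hF0 : β₀ = 0 ∧ α = 0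
  · obtain ⟨rfl, rfl⟩ := hF0
    exact gfreeT0 κ β₁ γ₁ γ₂
  by_cases hF1 : β₁ = 0 ∧ γ₁ = 0
  · obtain ⟨rfl, rfl⟩ := hF1
    exact gfreeT1 κ β₀ γ₂ α
  have hβ₁ : β₁ ≤ 1 := by omega
  have hγ₁ : γ₁ ≤ 1 := by omega
  -- D5 : γ₂ ≥ 2
  by_cases hD5 : 2 ≤ γ₂
  · obtain ⟨g, rfl⟩ : ∃ g, γ₂ = g + 1 := ⟨γ₂ - 1, by omega⟩
    have hg : 1 ≤ g := by omega
    rcases Nat.eq_zero_or_pos (κ 0) with h0 | h0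
    · exact gruleD5b κ β₀ β₁ γ₁ g α h0 hg hβ₁ hγ₁ hA fun κ' hκ' =>
        IH κ' _ _ _ _ _ hκ' (by simp only [Adm, MuLT, muP, Matrix.cons_val, true_and, and_true, Nat.add_sub_cancel, Nat.zero_sub]; omega)
    · exact gruleD5a κ β₀ β₁ γ₁ g α h0 hg hβ₁ hγ₁ hA fun κ' hκ' =>
        IH κ' _ _ _ _ _ hκ' (by simp only [Adm, MuLT, muP, Matrix.cons_val, true_and, and_true, Nat.add_sub_cancel, Nat.zero_sub]; omega)
  -- D5′ : β₀ ≥ 2, by duality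
  by_cases hD5' : 2 ≤ β₀
  · obtain ⟨g, rfl⟩ : ∃ g, β₀ = g + 1 := ⟨β₀ - 1, by omega⟩
    have hg : 1 ≤ g := by omega
    refine gdual κ (g + 1) β₁ γ₁ γ₂ α ?_
    rcases Nat.eq_zero_or_pos (κ 3) with h3 | h3
    · exact gruleD5b _ γ₂ γ₁ β₁ g α (by simp only [Matrix.cons_val]; exact h3) hg hγ₁ hβ₁
        (by simp only [Adm, MuLT, muP, Matrix.cons_val, true_and, and_true, Nat.add_sub_cancel, Nat.zero_sub]; omega) fun κ' hκ' =>
        IH κ' _ _ _ _ _ hκ' (by simp only [Adm, MuLT, muP, Matrix.cons_val, true_and, and_true, Nat.add_sub_cancel, Nat.zero_sub]; omega)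
    · exact gruleD5a _ γ₂ γ₁ β₁ g α (by simp only [Matrix.cons_val]; exact h3) hg hγ₁ hβ₁
        (by simp only [Adm, MuLT, muP, Matrix.cons_val, true_and, and_true, Nat.add_sub_cancel, Nat.zero_sub]; omega) fun κ' hκ' =>
        IH κ' _ _ _ _ _ hκ' (by simp only [Adm, MuLT, muP, Matrix.cons_val, true_and, and_true, Nat.add_sub_cancel, Nat.zero_sub]; omega)
  -- D6 : α ≥ 2
  by_cases hD6 : 2 ≤ α
  · obtain ⟨a, rfl⟩ : ∃ a, α = a + 1 := ⟨α - 1, by omega⟩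
    have ha : 1 ≤ a := by omega
    rcases Nat.eq_zero_or_pos γ₂ with h2 | h2
    · subst h2
      exact gruleD6 κ β₀ β₁ γ₁ a ha hβ₁ hA fun κ' hκ' =>
        IH κ' _ _ _ _ _ hκ' (by simp only [Adm, MuLT, muP, Matrix.cons_val, true_and, and_true, Nat.add_sub_cancel, Nat.zero_sub]; omega)
    · obtain rfl : γ₂ = 1 := by omega
      obtain rfl : β₀ = 0 := by omega
      refine gdual κ 0 β₁ γ₁ 1 (a + 1) ?_
      exact gruleD6 _ 1 γ₁ β₁ a ha hγ₁ (by simp only [Adm, MuLT, muP, Matrix.cons_val, true_and, and_true, Nat.add_sub_cancel, Nat.zero_sub]; omega)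
        fun κ' hκ' => IH κ' _ _ _ _ _ hκ' (by simp only [Adm, MuLT, muP, Matrix.cons_val, true_and, and_true, Nat.add_sub_cancel, Nat.zero_sub]; omega)
  -- D7 : κ₃ ≥ 1, β₀, α ≥ 1
  by_cases hD7 : 1 ≤ κ 3 ∧ 1 ≤ β₀ ∧ 1 ≤ α
  · obtain ⟨g, rfl⟩ : ∃ g, β₀ = g + 1 := ⟨β₀ - 1, by omega⟩
    obtain ⟨a, rfl⟩ : ∃ a, α = a + 1 := ⟨α - 1, by omega⟩
    exact gsplitD7 κ g β₁ γ₁ γ₂ a hD7.1 (by simp only [Adm, MuLT, muP, Matrix.cons_val, true_and, and_true, Nat.add_sub_cancel, Nat.zero_sub]; omega)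
      (IH _ _ _ _ _ _ (by simp only [Adm, MuLT, muP, Matrix.cons_val, true_and, and_true, Nat.add_sub_cancel, Nat.zero_sub]; omega)
        (by simp only [Adm, MuLT, muP, Matrix.cons_val, true_and, and_true, Nat.add_sub_cancel, Nat.zero_sub]; omega))
      (by simp only [Adm, MuLT, muP, Matrix.cons_val, true_and, and_true, Nat.add_sub_cancel, Nat.zero_sub]; omega)
      (IH _ _ _ _ _ _ (by simp only [Adm, MuLT, muP, Matrix.cons_val, true_and, and_true, Nat.add_sub_cancel, Nat.zero_sub]; omega)
        (by simp only [Adm, MuLT, muP, Matrix.cons_val, true_and, and_true, Nat.add_sub_cancel, Nat.zero_sub]; omega))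
  -- D7′ : κ₀ ≥ 1, γ₂, α ≥ 1, by duality
  by_cases hD7' : 1 ≤ κ 0 ∧ 1 ≤ γ₂ ∧ 1 ≤ α
  · obtain ⟨h, rfl⟩ : ∃ h, γ₂ = h + 1 := ⟨γ₂ - 1, by omega⟩
    obtain ⟨a, rfl⟩ : ∃ a, α = a + 1 := ⟨α - 1, by omega⟩
    refine gdual κ β₀ β₁ γ₁ (h + 1) (a + 1) ?_
    exact gsplitD7 _ h γ₁ β₁ β₀ a (by simp only [Matrix.cons_val]; exact hD7'.1)
      (by simp only [Adm, MuLT, muP, Matrix.cons_val, true_and, and_true, Nat.add_sub_cancel, Nat.zero_sub]; omega)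
      (IH _ _ _ _ _ _ (by simp only [Adm, MuLT, muP, Matrix.cons_val, true_and, and_true, Nat.add_sub_cancel, Nat.zero_sub]; omega)
        (by simp only [Adm, MuLT, muP, Matrix.cons_val, true_and, and_true, Nat.add_sub_cancel, Nat.zero_sub]; omega))
      (by simp only [Adm, MuLT, muP, Matrix.cons_val, true_and, and_true, Nat.add_sub_cancel, Nat.zero_sub]; omega)
      (IH _ _ _ _ _ _ (by simp only [Adm, MuLT, muP, Matrix.cons_val, true_and, and_true, Nat.add_sub_cancel, Nat.zero_sub]; omega)
        (by simp only [Adm, MuLT, muP, Matrix.cons_val, true_and, and_true, Nat.add_sub_cancel, Nat.zero_sub]; omega))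
  -- D8 : κ₂ ≥ 1, γ₁, γ₂ ≥ 1
  by_cases hD8 : 1 ≤ κ 2 ∧ 1 ≤ γ₁ ∧ 1 ≤ γ₂
  · obtain ⟨c, rfl⟩ : ∃ c, γ₁ = c + 1 := ⟨γ₁ - 1, by omega⟩
    obtain ⟨h, rfl⟩ : ∃ h, γ₂ = h + 1 := ⟨γ₂ - 1, by omega⟩
    exact gsplitD8 κ β₀ β₁ c h α hD8.1 (by simp only [Adm, MuLT, muP, Matrix.cons_val, true_and, and_true, Nat.add_sub_cancel, Nat.zero_sub]; omega)
      (IH _ _ _ _ _ _ (by simp only [Adm, MuLT, muP, Matrix.cons_val, true_and, and_true, Nat.add_sub_cancel, Nat.zero_sub]; omega)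
        (by simp only [Adm, MuLT, muP, Matrix.cons_val, true_and, and_true, Nat.add_sub_cancel, Nat.zero_sub]; omega))
      (by simp only [Adm, MuLT, muP, Matrix.cons_val, true_and, and_true, Nat.add_sub_cancel, Nat.zero_sub]; omega)
      (IH _ _ _ _ _ _ (by simp only [Adm, MuLT, muP, Matrix.cons_val, true_and, and_true, Nat.add_sub_cancel, Nat.zero_sub]; omega)
        (by simp only [Adm, MuLT, muP, Matrix.cons_val, true_and, and_true, Nat.add_sub_cancel, Nat.zero_sub]; omega))
  -- D8′ : κ₁ ≥ 1, β₁, β₀ ≥ 1, by duality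
  by_cases hD8' : 1 ≤ κ 1 ∧ 1 ≤ β₁ ∧ 1 ≤ β₀
  · obtain ⟨b, rfl⟩ : ∃ b, β₁ = b + 1 := ⟨β₁ - 1, by omega⟩
    obtain ⟨g, rfl⟩ : ∃ g, β₀ = g + 1 := ⟨β₀ - 1, by omega⟩
    refine gdual κ (g + 1) (b + 1) γ₁ γ₂ α ?_
    exact gsplitD8 _ γ₂ γ₁ b g α (by simp only [Matrix.cons_val]; exact hD8'.1)
      (by simp only [Adm, MuLT, muP, Matrix.cons_val, true_and, and_true, Nat.add_sub_cancel, Nat.zero_sub]; omega)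
      (IH _ _ _ _ _ _ (by simp only [Adm, MuLT, muP, Matrix.cons_val, true_and, and_true, Nat.add_sub_cancel, Nat.zero_sub]; omega)
        (by simp only [Adm, MuLT, muP, Matrix.cons_val, true_and, and_true, Nat.add_sub_cancel, Nat.zero_sub]; omega))
      (by simp only [Adm, MuLT, muP, Matrix.cons_val, true_and, and_true, Nat.add_sub_cancel, Nat.zero_sub]; omega)
      (IH _ _ _ _ _ _ (by simp only [Adm, MuLT, muP, Matrix.cons_val, true_and, and_true, Nat.add_sub_cancel, Nat.zero_sub]; omega)
        (by simp only [Adm, MuLT, muP, Matrix.cons_val, true_and, and_true, Nat.add_sub_cancel, Nat.zero_sub]; omega))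
  -- D9 : κ₂ ≥ 1, β₀, β₁, α ≥ 1
  by_cases hD9 : 1 ≤ κ 2 ∧ 1 ≤ β₀ ∧ 1 ≤ β₁ ∧ 1 ≤ α
  · obtain ⟨g, rfl⟩ : ∃ g, β₀ = g + 1 := ⟨β₀ - 1, by omega⟩
    obtain ⟨b, rfl⟩ : ∃ b, β₁ = b + 1 := ⟨β₁ - 1, by omega⟩
    obtain ⟨a, rfl⟩ : ∃ a, α = a + 1 := ⟨α - 1, by omega⟩
    exact gsplitD9 κ g b γ₁ γ₂ a hD9.1 (by simp only [Adm, MuLT, muP, Matrix.cons_val, true_and, and_true, Nat.add_sub_cancel, Nat.zero_sub]; omega)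
      (IH _ _ _ _ _ _ (by simp only [Adm, MuLT, muP, Matrix.cons_val, true_and, and_true, Nat.add_sub_cancel, Nat.zero_sub]; omega)
        (by simp only [Adm, MuLT, muP, Matrix.cons_val, true_and, and_true, Nat.add_sub_cancel, Nat.zero_sub]; omega))
      (by simp only [Adm, MuLT, muP, Matrix.cons_val, true_and, and_true, Nat.add_sub_cancel, Nat.zero_sub]; omega)
      (IH _ _ _ _ _ _ (by simp only [Adm, MuLT, muP, Matrix.cons_val, true_and, and_true, Nat.add_sub_cancel, Nat.zero_sub]; omega)
        (by simp only [Adm, MuLT, muP, Matrix.cons_val, true_and, and_true, Nat.add_sub_cancel, Nat.zero_sub]; omega))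
      (by simp only [Adm, MuLT, muP, Matrix.cons_val, true_and, and_true, Nat.add_sub_cancel, Nat.zero_sub]; omega)
      (IH _ _ _ _ _ _ (by simp only [Adm, MuLT, muP, Matrix.cons_val, true_and, and_true, Nat.add_sub_cancel, Nat.zero_sub]; omega)
        (by simp only [Adm, MuLT, muP, Matrix.cons_val, true_and, and_true, Nat.add_sub_cancel, Nat.zero_sub]; omega))
  -- D9′ : κ₁ ≥ 1, γ₂, γ₁, α ≥ 1, by duality
  by_cases hD9' : 1 ≤ κ 1 ∧ 1 ≤ γ₂ ∧ 1 ≤ γ₁ ∧ 1 ≤ α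
  · obtain ⟨h, rfl⟩ : ∃ h, γ₂ = h + 1 := ⟨γ₂ - 1, by omega⟩
    obtain ⟨c, rfl⟩ : ∃ c, γ₁ = c + 1 := ⟨γ₁ - 1, by omega⟩
    obtain ⟨a, rfl⟩ : ∃ a, α = a + 1 := ⟨α - 1, by omega⟩
    refine gdual κ β₀ β₁ (c + 1) (h + 1) (a + 1) ?_
    exact gsplitD9 _ h c β₁ β₀ a (by simp only [Matrix.cons_val]; exact hD9'.1)
      (by simp only [Adm, MuLT, muP, Matrix.cons_val, true_and, and_true, Nat.add_sub_cancel, Nat.zero_sub]; omega)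
      (IH _ _ _ _ _ _ (by simp only [Adm, MuLT, muP, Matrix.cons_val, true_and, and_true, Nat.add_sub_cancel, Nat.zero_sub]; omega)
        (by simp only [Adm, MuLT, muP, Matrix.cons_val, true_and, and_true, Nat.add_sub_cancel, Nat.zero_sub]; omega))
      (by simp only [Adm, MuLT, muP, Matrix.cons_val, true_and, and_true, Nat.add_sub_cancel, Nat.zero_sub]; omega)
      (IH _ _ _ _ _ _ (by simp only [Adm, MuLT, muP, Matrix.cons_val, true_and, and_true, Nat.add_sub_cancel, Nat.zero_sub]; omega)
        (by simp only [Adm, MuLT, muP, Matrix.cons_val, true_and, and_true, Nat.add_sub_cancel, Nat.zero_sub]; omega))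
      (by simp only [Adm, MuLT, muP, Matrix.cons_val, true_and, and_true, Nat.add_sub_cancel, Nat.zero_sub]; omega)
      (IH _ _ _ _ _ _ (by simp only [Adm, MuLT, muP, Matrix.cons_val, true_and, and_true, Nat.add_sub_cancel, Nat.zero_sub]; omega)
        (by simp only [Adm, MuLT, muP, Matrix.cons_val, true_and, and_true, Nat.add_sub_cancel, Nat.zero_sub]; omega))
  -- NONE: the decision list is exhaustive on admissible classes
  exfalso
  omega

/-- **INDUCTION ON `μ`**: every admissible gap class satisfies the clause. -/
theorem gapClass_all : ∀ (p m s : ℕ) (κ : Fin 4 → ℕ) (β₀ β₁ γ₁ γ₂ α : ℕ), muP β₀ β₁ γ₁ γ₂ α ≤ p → max β₀ γ₂ ≤ m →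
    β₀ + β₁ + γ₁ + γ₂ + α ≤ s → Adm κ β₀ β₁ γ₁ γ₂ α → GClause κ β₀ β₁ γ₁ γ₂ α := by
  intro p
  refine Nat.strong_induction_on p fun p ihp => ?_
  intro m
  refine Nat.strong_induction_on m fun m ihm => ?_
  intro s
  refine Nat.strong_induction_on s fun s ihs => ?_
  intro κ β₀ β₁ γ₁ γ₂ α hp hm hs hA
  refine gapClass_step κ β₀ β₁ γ₁ γ₂ α hA fun κ' b0 b1 c1 c2 al hA' hlt => ?_
  rcases hlt with h | ⟨h1, h | ⟨h2, h⟩⟩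
  · exact ihp _ (by omega) _ _ κ' b0 b1 c1 c2 al le_rfl le_rfl le_rfl hA'
  · exact ihm _ (by omega) _ κ' b0 b1 c1 c2 al (by omega) le_rfl le_rfl hA'
  · exact ihs _ (by omega) κ' b0 b1 c1 c2 al (by omega) (by omega) le_rfl hA'

/-- **`stub_gapClassMatch` PROVED (skeleton `gz_ladder` v4 on `stmt-KontsevichZagierPeriods-32433`): every admissible scaled gap class is
congruent into `layerThree ∪ gzLETwo`.**  With `stub_three_match_of_gapClassMatch` (WordMatchPrelude P6) this closes `stub_three_match`. -/
theorem stub_gapClassMatch : GapClassMatch := by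
  intro q κ β₀ β₁ γ₁ γ₂ α h1 h2 h3 h4 h5 r hd hi
  exact gapClass_all _ _ _ κ β₀ β₁ γ₁ γ₂ α le_rfl le_rfl le_rfl ⟨h1, h2, h3, h4, h5⟩ q r hd hi

end GapClassInduction

end Summit.KontsevichZagierPeriods.KontsevichZagierPeriods.Cruxes.GZNormalFormWThree.GZLadder
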